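import Summits.Ventures.HodgeRepro2.T6Interface

/-!
# T6A2Model — sub-claim A2 on the explicit model: the complexified `K`-action `[x]^*_ℂ`, its eigenvectors
`ι u ∧ ι v` (TIER4 A0.4), and the Hodge type of a `(1,0) ∧ (0,1)` wedge (TIER4 Lemma A0.5 / A4.2.2)

Cell pub-hodge-repro2, Tier 6 (README §10), seat t6-p2 (A2 owner). Layer II over `T6Interface` v0 (p400082)
per TARGET-T6.md §2/§7(b). Definition lane: two definitions (`actH1C`, `pullEndoC`), the rest theorems.

* `actH1C K x` — the complexified action `v ↦ (i ↦ (1 ⊗ x) · v i)` on `H¹(B, ℂ) = Fin 4 → K ⊗ ℂ`;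
  `pullEndoC K x := ExteriorAlgebra.map (actH1C K x)` — `[x]^*_ℂ` on `H^*(B, ℂ)`.
* `extC_ι`, `pullEndo_ι`, `extC_pullEndo`, `extC_pullEndo_pow`, `extC_aeval` — the complexification `extC` of
  the interface intertwines `[x]^*` with `[x]^*_ℂ`, hence every polynomial in them (TIER4 A0.3(ii); this is
  how the RATIONAL projector `Q([x]^*)` of Lemma A4.2.2 is read after `⊗ ℂ`).
* `actH1C_eq_smul_of_mem_eigenLine`, `pullEndoC_ι_of_mem_eigenLine`, `pullEndoC_ι_mul_ι`,
  `ι_mul_ι_mem_eigenspace` — on `ℓ_{i,σ} ∧ ℓ_{j,σ'}` the action is the scalar `σ(x)σ'(x)` (TIER4 A0.4).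
* `ι_mem_ιW_h10`, `ι_mem_ιW_h01`, `ι_mul_ι_mem_hodge11` — a wedge of a `(1,0)`-line and a `(0,1)`-line has
  Hodge type `(1,1)` in the interface's `hodge F 1 1` (TIER4 A4.2.2 "Hodge type", from Lemma A0.5 = the
  interface's definitions `h10` / `h01`).

Nothing here is a printed fact: every statement is a computation in the explicit exterior-algebra model of
`T6Interface`. Uses no `sorry`, no axiom beyond the standard trio.
-/
namespace Summit.Ventures.HodgeRepro2.T6.A2Model

open Summit.Ventures.HodgeRepro2.T6 Polynomial

variable (K : Type*) [Field K] [NumberField K]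

/-- The complexified `K`-action on `H¹(B, ℂ) = Fin 4 → K ⊗ ℂ`: `v ↦ (i ↦ (1 ⊗ x) * v i)` (ℂ-linear). -/
noncomputable def actH1C (x : K) : H1C K →ₗ[ℂ] H1C K :=
  LinearMap.pi fun i =>
    (LinearMap.mul ℂ (KC K) (Algebra.TensorProduct.includeRight x)) ∘ₗ LinearMap.proj i

/-- The complexified `[x]^*` on `H^*(B, ℂ)`: the ℂ-algebra endomorphism induced by `actH1C x`. -/
noncomputable def pullEndoC (x : K) : HBC K →ₐ[ℂ] HBC K :=
  ExteriorAlgebra.map (actH1C K x)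

/-- `actH1C x v` componentwise: `(actH1C x v) i = (1 ⊗ x) * v i`. -/
theorem actH1C_apply (x : K) (v : H1C K) (i : Fin 4) :
    actH1C K x v i = (Algebra.TensorProduct.includeRight x : KC K) * v i := rfl

/-- `[x]^*_ℂ` on a generator: `pullEndoC x (ι v) = ι (actH1C x v)`. -/
theorem pullEndoC_ι (x : K) (v : H1C K) :
    pullEndoC K x (ExteriorAlgebra.ι ℂ v) = ExteriorAlgebra.ι ℂ (actH1C K x v) :=
  ExteriorAlgebra.map_apply_ι _ _

/-- The complexification intertwines the two actions on `H¹`. -/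
theorem h1ToC_actH1 (x : K) (v : H1 K) : h1ToC K (actH1 K x v) = actH1C K x (h1ToC K v) := by
  ext i
  simp [h1ToC, actH1, actH1C]

/-- `extC` on a generator: `extC (ι v) = ι (h1ToC v)`. -/
theorem extC_ι (v : H1 K) : extC K (ExteriorAlgebra.ι ℚ v) = ExteriorAlgebra.ι ℂ (h1ToC K v) := by
  rw [extC, ExteriorAlgebra.lift_ι_apply]; rfl

/-- `[x]^*` on a generator: `pullEndo x (ι v) = ι (actH1 x v)`. -/
theorem pullEndo_ι (x : K) (v : H1 K) :
    pullEndo K x (ExteriorAlgebra.ι ℚ v) = ExteriorAlgebra.ι ℚ (actH1 K x v) := by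
  rw [pullEndo, ExteriorAlgebra.lift_ι_apply]; rfl

/-- `extC ∘ [x]^* = [x]^*_ℂ ∘ extC` (TIER4 A0.3(ii): the K-action commutes with complexification). -/
theorem extC_pullEndo (x : K) (a : HB K) : extC K (pullEndo K x a) = pullEndoC K x (extC K a) := by
  have h : (extC K).comp (pullEndo K x) = ((pullEndoC K x).restrictScalars ℚ).comp (extC K) := by
    apply ExteriorAlgebra.hom_ext
    refine LinearMap.ext fun v => ?_
    simp only [AlgHom.comp_toLinearMap, LinearMap.comp_apply, AlgHom.toLinearMap_apply,
      AlgHom.coe_restrictScalars']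
    rw [pullEndo_ι, extC_ι, extC_ι, pullEndoC_ι, h1ToC_actH1]
  exact congrArg (fun f => f a) h

/-- `extC ∘ ([x]^*)^n = ([x]^*_ℂ)^n ∘ extC`. -/
theorem extC_pullEndo_pow (x : K) (n : ℕ) (a : HB K) :
    extC K (((pullEndo K x).toLinearMap ^ n) a) =
      ((pullEndoC K x).toLinearMap ^ n) (extC K a) := by
  induction n with
  | zero => simp
  | succ n ih =>
    rw [pow_succ', pow_succ', Module.End.mul_apply, Module.End.mul_apply, AlgHom.toLinearMap_apply,
      AlgHom.toLinearMap_apply, extC_pullEndo, ih]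

/-- Polynomial compatibility: `extC (Q([x]^*) a) = Q([x]^*_ℂ) (extC a)` for `Q ∈ ℚ[X]` read in `ℂ[X]`
(the rational projector of Lemma A4.2.2 complexifies to the Lagrange projector). -/
theorem extC_aeval (x : K) (Q : ℚ[X]) (a : HB K) :
    extC K (aeval (pullEndo K x).toLinearMap Q a) =
      aeval (pullEndoC K x).toLinearMap (Q.map (algebraMap ℚ ℂ)) (extC K a) := by
  induction Q using Polynomial.induction_on' with
  | add p q hp hq =>
    rw [map_add, Polynomial.map_add, map_add, LinearMap.add_apply, LinearMap.add_apply, map_add,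
      hp, hq]
  | monomial n c =>
    rw [Polynomial.map_monomial, aeval_monomial, aeval_monomial, Module.End.mul_apply,
      Module.End.mul_apply, Module.algebraMap_end_apply, Module.algebraMap_end_apply, map_smul,
      extC_pullEndo_pow, algebraMap_smul]

/-! ### Eigenvectors of the complexified action (TIER4 A0.4: `ι_i(x)^*` is the scalar `σ(x)σ'(x)` on `ℓ_{i,σ} ∧ ℓ_{i,σ'}`) -/

/-- On the `σ`-eigenline of the `i`-th vertex, `actH1C x` is the scalar `σ x`. -/
theorem actH1C_eq_smul_of_mem_eigenLine (x : K) {i : Fin 4} {σ : K →+* ℂ} {u : H1C K}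
    (hu : u ∈ eigenLine K i σ) : actH1C K x u = σ x • u := by
  obtain ⟨e, he, rfl⟩ := Submodule.mem_map.mp hu
  ext j
  simp only [actH1C_apply, Pi.smul_apply, LinearMap.single_apply]
  by_cases h : j = i
  · subst h
    have := he x
    simp only [Algebra.TensorProduct.includeRight_apply] at this
    simpa using this
  · simp [h]

/-- `[x]^*_ℂ (ι u) = σ x • ι u` for `u ∈ ℓ_{i,σ}`. -/
theorem pullEndoC_ι_of_mem_eigenLine (x : K) {i : Fin 4} {σ : K →+* ℂ} {u : H1C K}
    (hu : u ∈ eigenLine K i σ) :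
    pullEndoC K x (ExteriorAlgebra.ι ℂ u) = σ x • ExteriorAlgebra.ι ℂ u := by
  rw [pullEndoC_ι, actH1C_eq_smul_of_mem_eigenLine K x hu, map_smul]

/-- `[x]^*_ℂ (ι u * ι v) = (σ x * σ' x) • (ι u * ι v)` for `u ∈ ℓ_{i,σ}`, `v ∈ ℓ_{j,σ'}`. -/
theorem pullEndoC_ι_mul_ι (x : K) {i j : Fin 4} {σ σ' : K →+* ℂ} {u v : H1C K}
    (hu : u ∈ eigenLine K i σ) (hv : v ∈ eigenLine K j σ') :
    pullEndoC K x (ExteriorAlgebra.ι ℂ u * ExteriorAlgebra.ι ℂ v) =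
      (σ x * σ' x) • (ExteriorAlgebra.ι ℂ u * ExteriorAlgebra.ι ℂ v) := by
  rw [map_mul, pullEndoC_ι_of_mem_eigenLine K x hu, pullEndoC_ι_of_mem_eigenLine K x hv,
    smul_mul_smul_comm]

/-- `ι u * ι v` is an eigenvector of `[x]^*_ℂ` with eigenvalue `σ x * σ' x`. -/
theorem ι_mul_ι_mem_eigenspace (x : K) {i j : Fin 4} {σ σ' : K →+* ℂ} {u v : H1C K}
    (hu : u ∈ eigenLine K i σ) (hv : v ∈ eigenLine K j σ') :
    ExteriorAlgebra.ι ℂ u * ExteriorAlgebra.ι ℂ v ∈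
      Module.End.eigenspace (pullEndoC K x).toLinearMap (σ x * σ' x) :=
  Module.End.mem_eigenspace_iff.mpr (pullEndoC_ι_mul_ι K x hu hv)

/-! ### Hodge types (TIER4 Lemma A0.5 / A4.2.2 "Hodge type": one of `σ, σ̄` lies in `T i`) -/

variable {K}

/-- `ι u ∈ ιW (h10 F)` for `u ∈ ℓ_{i,σ}`, `σ ∈ T i`. -/
theorem ι_mem_ιW_h10 (F : FaceSetting K) {i : Fin 4} {σ : K →+* ℂ} (hσ : σ ∈ F.T i) {u : H1C K}
    (hu : u ∈ eigenLine K i σ) : ExteriorAlgebra.ι ℂ u ∈ ιW (h10 F) :=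
  Submodule.mem_map_of_mem (Submodule.mem_iSup_of_mem i (Submodule.mem_iSup_of_mem σ
    (Submodule.mem_iSup_of_mem hσ hu)))

/-- `ι u ∈ ιW (h01 F)` for `u ∈ ℓ_{i,σ}`, `σ ∉ T i`. -/
theorem ι_mem_ιW_h01 (F : FaceSetting K) {i : Fin 4} {σ : K →+* ℂ} (hσ : σ ∉ F.T i) {u : H1C K}
    (hu : u ∈ eigenLine K i σ) : ExteriorAlgebra.ι ℂ u ∈ ιW (h01 F) :=
  Submodule.mem_map_of_mem (Submodule.mem_iSup_of_mem i (Submodule.mem_iSup_of_mem σ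
    (Submodule.mem_iSup_of_mem (Set.mem_compl hσ) hu)))

/-- A wedge of a `(1,0)`-line and a `(0,1)`-line is of type `(1,1)`, in either order
(`ι v * ι u = −(ι u * ι v)`). -/
theorem ι_mul_ι_mem_hodge11 (F : FaceSetting K) {i j : Fin 4} {σ σ' : K →+* ℂ} (hσ : σ ∈ F.T i)
    (hσ' : σ' ∉ F.T j) {u v : H1C K} (hu : u ∈ eigenLine K i σ) (hv : v ∈ eigenLine K j σ') :
    ExteriorAlgebra.ι ℂ u * ExteriorAlgebra.ι ℂ v ∈ hodge F 1 1 ∧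
      ExteriorAlgebra.ι ℂ v * ExteriorAlgebra.ι ℂ u ∈ hodge F 1 1 := by
  have h1 : ExteriorAlgebra.ι ℂ u * ExteriorAlgebra.ι ℂ v ∈ hodge F 1 1 := by
    unfold hodge
    rw [pow_one, pow_one]
    exact Submodule.mul_mem_mul (ι_mem_ιW_h10 F hσ hu) (ι_mem_ιW_h01 F hσ' hv)
  refine ⟨h1, ?_⟩
  have h2 : ExteriorAlgebra.ι ℂ v * ExteriorAlgebra.ι ℂ u =
      -(ExteriorAlgebra.ι ℂ u * ExteriorAlgebra.ι ℂ v) := by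
    rw [eq_neg_iff_add_eq_zero, add_comm]
    exact ExteriorAlgebra.ι_add_mul_swap u v
  rw [h2]
  exact Submodule.neg_mem _ h1

end Summit.Ventures.HodgeRepro2.T6.A2Model
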